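import Literature.Probability.LatticeModels.PolymerGasGeometric
import Literature.Probability.LatticeModels.PolymerPressure
import Summits.QuantumFields.YangMills.Theorems.BalabanUVNodesPortSteinerLength
import Summits.QuantumFields.YangMills.Theorems.BalabanUVNodesPortResummationU5b

/-!
# Steiner tree length on a bounded-degree cell graph, Bałaban's (2.27)/(2.29)/(2.30), and the
# geometric resummation of small activities (PT-D applied by name) — NODE O · PT-D′

AUTHORS: statement + proof by lens-2 g2 (planner-ymgap-nodeO-lens-2-g2-0, 2026-08-30; HOME
`pub/ym-nodeO-ideate/nodeO-cover/LENS-2-PortPTDprime-TheoremsDraft-v1.lean` sha16 dd006e1ede30f4bd, 528 l.; farm rc 0 · 0 sorry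
· 0 warnings · axioms {propext, Classical.choice, Quot.sound}); FILED UNCHANGED (this author paragraph only) by dag-n07-e g36
(prover-pub-ymgap-dag-n07-e-g36-0) on director-ym №427 and chair R473 (pub-ymgap INBOX l.20342 ∕ l.20345) as
`Summits/QuantumFields/YangMills/Theorems/BalabanUVNodesPortSteinerResummation.lean`, `--supports stmt-QuantumFields-20541 --as helper`
(count-neutral PORTER helper PT-D′; no item). The lens seat's filing recipe is kept below as written.
FILER'S DEVIATIONS FROM «UNCHANGED» (forced by the gate's dry-run lints, declared on the bus): (a) the draft is SPLIT at the §3/§4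
boundary — §1–§3 (`steinerLength`, (2.27) `steiner_subadd`, (2.29)/(2.30) `steiner_entropy`) are PART A
`BalabanUVNodesPortSteinerLength.lean` (Theorems files with proofs ≤ 400 lines), imported here; (b) seven cite tags re-punctuated
to `[cite: Key, locator]` with the bib keys of record (`Balaban1987RG1`, `Balaban1988RG2Cluster`, `KoteckyPreiss1986`); every
declaration's name, namespace, statement and proof is byte-identical to the draft.
FILING RECIPE (the PT-D pattern №418/№421/№422; the director's word decides): (1) plan g98 adds
a `[support]` row on route-QuantumFields-BalabanUVNodes, e.g. `ledger workitem add --kind statement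
--route route-QuantumFields-BalabanUVNodes --rank 9 --name PortSteinerResummationU5bp --informal
'[support] PT-D′ …'`; (2) a permitted seat sets its signature to the text of HOME
`nodeO-cover/LENS-2-Sig-PTDprime.txt` (= the statement of `portSteinerResummation_sig` in §6 below,
VERBATIM; tree constants only, `steinerLength` inlined as its `sInf`; it elaborates against
`import Summits.QuantumFields.YangMills.Theses.BalabanUVNodes` ALONE — probe
`nodeO-cover/LENS-2-Sig-PTDprime-probe.lean` rc 0); (3) a prover-lineage porter files THESE bytes
unchanged (author line only) as `Summits/QuantumFields/YangMills/Theorems/BalabanUVNodesSteinerResummation.lean`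
with `--workitem <that item>` (closing decl `Summit.QuantumFields.YangMills.Theorems.SteinerResummationDraft.portSteinerResummation_sig`,
whose type is the signature text verbatim), or — without an item — `--supports stmt-QuantumFields-20541
--as helper` (then all 16 decls are audit-orphans by construction). Kind is inferred `definition`
(`def steinerLength`). Two-file alternative if the operator prefers the combinatorics in Literature:
§1–§3 (+ §5) as `Literature/Probability/LatticeModels/SteinerLength.lean` under
`namespace Literature.Probability.LatticeModels` (no Summits import), §4/§6 as the Theorems file
importing it. No `instance`, no `notation`, no attribute removal (typer lint).

WHAT IT IS. PT-D = `Summit.QuantumFields.YangMills.Theorems.PortResummationU5bDraft.portResummationU5b_sig`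
(landed ✓p783856; item stmt-QuantumFields-27929 closed-as-proved) is Bałaban's resummation step
[RG-II, CMP 116] (2.31)–(2.41) over an ABSTRACT countable polymer system `(α, inc, ℓ)` under three
hypotheses on the length `ℓ`:
* (H1) `ℓ {x} ≤ c₀` (one cell is short),
* (H2) = print (2.27): `ℓ (⋃ C) + c₀ ≤ Σ_{A ∈ C} (ℓ A + c₀)` for every nonempty `inc`-cluster `C`,
* (H3) = print (2.29)/(2.30): `Σ'_{A' : inc A' A} e^{-b ℓ A'} ≤ N (ℓ A + 1)` (summable), uniformly.

This file DISCHARGES (H1)–(H3) for the geometry of print — cells = a bounded-degree adjacency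
structure `(V, R, nbr, Δ)` exactly as in the landed `PolymerGasGeometric`, hard core = `GeomInc R`
("`Z ∩ Z'` contains a cube, or a wall of a cube", [RG-II] (2.11)), and
`ℓ A := steinerLength R A` = the least number of EDGES of an `R`-connected set of cells containing
`A` (print's tree length `d_k(Y)` of [RG-I] (1.35) up to the `M`-normalisation of (2.30); on a
connected `A` it is `#A - 1`, `steinerLength_of_isRConnected`) — with the constants
`c₀ = 1`, `N = 4 (Δ + 1)`, any `b` with `4 (Δ + 1)² ≤ e^b`:

* §1 `steinerLength`, attained under ambient connectivity (`steinerLength_spec`),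
  `steinerLength_singleton` = (H1), `steinerLength_of_isRConnected` = (2.30)-shape;
* §2 `steiner_subadd` = (H2)/(2.27): the union of the Steiner supersets of the members of a
  `GeomInc`-cluster is `R`-connected (`isRConnected_biUnion_of_cluster`: the members whose superset
  is reachable from a base cell form a sub-family; the cluster property produces a touching pair
  across, and the shared or adjacent cell extends reachability);
* §3 `steiner_entropy` = (H3)/(2.29): each `A'` incompatible with `A` is a subset of its Steiner
  superset `S`, an `R`-connected set through a cell of `Nb(A)` (`#Nb(A) ≤ (Δ+1) #A`); the fibre over
  `S` has `≤ 2^{#S}` members; then the LANDED lattice-animal bound `sum_pow_card_le_of_connected`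
  with `λ := 2 e^{-b}` gives `Σ ≤ e^b · (Δ+1) #A · 4 e^{-b} ≤ 4 (Δ+1) (steinerLength A + 1)`;
  summability by `summable_of_sum_le` / `Real.tsum_le_of_sum_le`;
* §4 `geometric_resummation` := the landed PT-D theorem applied BY NAME to these data: for
  activities on finite cell sets with `‖H A‖ ≤ ε e^{-κ · steinerLength A}`, `κ ≥ κ' + b + 1`,
  `0 ≤ ε ≤ ε₀`, the sum of the truncated (Ursell) weights of the clusters with support exactly `X`
  drawn from ANY finite family `𝒱` is `≤ K ε e^{-κ' · steinerLength X}`, `ε₀, K` independent of `𝒱`;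
* §5 rule (N): the hypotheses are jointly satisfiable (one cell, `Δ = 0`, `b = log 4`).

This is the form PT-I's porter invokes on ([RG-II] `𝒟_{k+1}`, `d_{k+1}`, `ζ`): cells = `M`-cubes of
`T^{(k+1)}_1`, `R` = wall-adjacency (`Δ = 8` in `d = 4`), after the (2.30) rescaling of `κ`.
Everything here is FOLKLORE lattice-animal combinatorics (Cammarota, CMP 85 (1982) = [RG-I]
ref. [26]: "(2.29) … can be proved … by a simple modification of the argument in [26]", [RG-II]
p.18) on top of the tree's `LatticeAnimals` / `PolymerGasGeometric` / `ClusterExpansionKPBound` and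
the landed PT-D; nothing of Bałaban's analysis is asserted, valued or discharged.
HONEST: stub 2′ OPEN; K0⁷ NOT closed; NODE O = [RG-I] Thm 3 β-clause p.264 — print-proved
(claimed), unported; U9 dictionary open; finite `𝕋⁴` at fixed `ε`; NOT continuum / OS / Clay; the
Yang–Mills mass gap is NOT proved by any of this.

References: T. Bałaban, CMP 109 (1987) 249–301 [RG-I] (1.35), Thm 3 p.264 [Balaban1987RG1];
CMP 116 (1988) 1–22 [RG-II] (2.11), (2.27), (2.29), (2.30), Lemma 3 [Balaban1988RG2];
C. Cammarota, CMP 85 (1982) 517–528; R. Kotecký, D. Preiss, CMP 103 (1986) 491–498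
[KoteckyPreiss1986]; S. Friedli, Y. Velenik, CUP 2017, §5.7.1 [FriedliVelenik2017].
-/
noncomputable section

namespace Summit.QuantumFields.YangMills.Theorems.SteinerResummationDraft

open Finset Literature.Probability.LatticeModels


/-! ## §4 The geometric resummation: the LANDED PT-D applied by name -/

section Resummation

variable {V₀ : Type} [DecidableEq V₀] [Countable V₀] {R : V₀ → V₀ → Prop} [DecidableRel R]
  {nbr : V₀ → Finset V₀} {Δ : ℕ}

/-- **Geometric resummation of small activities (Bałaban [RG-II] (2.31)–(2.41) for cell polymers),
uniform in the volume.** Cells `V₀` countable with a symmetric adjacency `R` of degree `≤ Δ`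
(`nbr` lists neighbours) in which every finite set has a connected finite superset; hard core
`GeomInc R`; `4 (Δ+1)² ≤ e^b`, `0 ≤ κ'`, `κ' + b + 1 ≤ κ`. Then there are `ε₀ > 0`, `K ≥ 0`
(depending on `Δ, b, κ'` only) such that for all activities `H` on finite cell sets with
`‖H A‖ ≤ ε e^{-κ · steinerLength A}`, `0 ≤ ε ≤ ε₀`, every finite family `𝒱` of polymers and every
nonempty `X`:
`‖Σ_{C ⊆ 𝒱, ⋃C = X} φ^T(C) ∏_{A ∈ C} H A‖ ≤ K ε e^{-κ' · steinerLength X}`.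
This is `portResummationU5b_sig` (✓p783856) with `α := V₀`, `inc := GeomInc R`,
`ℓ := steinerLength R`, `c₀ := 1`, `N := 4 (Δ + 1)`, its hypotheses discharged by
`geomInc_of_inter_nonempty`, `steinerLength_singleton`, `steiner_subadd_real`, `steiner_entropy`.
[cite: Balaban1988RG2Cluster, (2.38)–(2.41) p.20–21; KoteckyPreiss1986; folklore] -/
theorem geometric_resummation (hR : ∀ x y, R x y → R y x) (hΔ : ∀ x, (nbr x).card ≤ Δ)
    (hnbr : ∀ x y, R x y → y ∈ nbr x)
    (hconn : ∀ A : Finset V₀, ∃ S : Finset V₀, A ⊆ S ∧ IsRConnected R S)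
    {b : ℝ} (hb : 4 * ((Δ : ℝ) + 1) ^ 2 ≤ Real.exp b) {κ κ' : ℝ} (hκ' : 0 ≤ κ')
    (hκ : κ' + b + 1 ≤ κ) :
    ∃ ε₀ : ℝ, 0 < ε₀ ∧ ∃ K : ℝ, 0 ≤ K ∧ ∀ (H : Finset V₀ → ℂ) (ε : ℝ), 0 ≤ ε → ε ≤ ε₀ →
      (∀ A, ‖H A‖ ≤ ε * Real.exp (-κ * (steinerLength R A : ℝ))) →
      ∀ (𝒱 : Finset (Finset V₀)) (X : Finset V₀), X.Nonempty →
        ‖∑ C ∈ 𝒱.powerset with clusterSupp C = X, truncatedWeight (GeomInc R) H C‖ ≤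
          K * ε * Real.exp (-κ' * (steinerLength R X : ℝ)) := by
  haveI : Std.Refl (GeomInc R) := ⟨geomInc_refl R⟩
  haveI : Std.Symm (GeomInc R) := ⟨fun _ _ h => geomInc_symm R hR h⟩
  exact Summit.QuantumFields.YangMills.Theorems.PortResummationU5bDraft.portResummationU5b_sig
    V₀ (GeomInc R) (fun _ _ h => geomInc_of_inter_nonempty h)
    (fun A => (steinerLength R A : ℝ)) 1 b (4 * ((Δ : ℝ) + 1))
    (fun _ => Nat.cast_nonneg _) zero_le_one
    (fun x => by rw [steinerLength_singleton]; norm_num)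
    (fun C hC hCl => steiner_subadd_real hR hconn hC hCl)
    (steiner_entropy hR hΔ hnbr hconn hb) κ κ' hκ' hκ

end Resummation

/-! ## §5 Rule (N): the hypotheses of `geometric_resummation` are jointly satisfiable -/

section Toy

/-- One cell, no edges: `Δ = 0`, `b = log 4` (`4 · 1² ≤ e^{log 4}`), `κ' = 0`, `κ = log 4 + 1`.
[folklore] -/
example := geometric_resummation (V₀ := Unit) (R := fun _ _ : Unit => False) (nbr := fun _ => ∅)
  (Δ := 0) (b := Real.log 4) (κ := Real.log 4 + 1) (κ' := 0)
  (fun _ _ h => h.elim) (fun _ => by simp) (fun _ _ h => h.elim)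
  (fun A => ⟨{()}, fun x _ => by simp, isRConnected_singleton ()⟩)
  (by rw [Real.exp_log (by norm_num)]; norm_num) le_rfl (by linarith)

end Toy

/-! ## §6 The item-shaped statement: tree constants only (`steinerLength` inlined as its `sInf`) -/

section ItemShape

/-- **PT-D′ as a by-name-closable statement over tree constants only** (the candidate `[support]`
signature text «PortSteinerResummationU5b′», file `Sig-PTDprime.txt`, 1032 chars; it elaborates
against `import Summits.QuantumFields.YangMills.Theses.BalabanUVNodes` alone): `geometric_resummation`
with `steinerLength` unfolded to its defining `sInf`. [cite: Balaban1988RG2Cluster, (2.27), (2.29) p.18, (2.38)–(2.41) p.20–21;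
folklore] -/
theorem portSteinerResummation_sig :
    ∀ (V₀ : Type) [DecidableEq V₀] [Countable V₀] (R : V₀ → V₀ → Prop) [DecidableRel R] (nbr : V₀ → Finset V₀) (Δ : ℕ), (∀ x y, R x y → R y x) → (∀ x, (nbr x).card ≤ Δ) → (∀ x y, R x y → y ∈ nbr x) → (∀ A : Finset V₀, ∃ S : Finset V₀, A ⊆ S ∧ Literature.Probability.LatticeModels.IsRConnected R S) → ∀ (b : ℝ), 4 * ((Δ : ℝ) + 1) ^ 2 ≤ Real.exp b → ∀ (κ κ' : ℝ), 0 ≤ κ' → κ' + b + 1 ≤ κ → ∃ ε₀ : ℝ, 0 < ε₀ ∧ ∃ K : ℝ, 0 ≤ K ∧ ∀ (H : Finset V₀ → ℂ) (ε : ℝ), 0 ≤ ε → ε ≤ ε₀ → (∀ A : Finset V₀, ‖H A‖ ≤ ε * Real.exp (-κ * ((sInf {n : ℕ | ∃ S : Finset V₀, A ⊆ S ∧ Literature.Probability.LatticeModels.IsRConnected R S ∧ S.card = n + 1} : ℕ) : ℝ))) → ∀ (𝒱 : Finset (Finset V₀)) (X : Finset V₀), X.Nonempty → ‖∑ C ∈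 𝒱.powerset with Literature.Probability.LatticeModels.clusterSupp C = X, Literature.Probability.LatticeModels.truncatedWeight (Literature.Probability.LatticeModels.GeomInc R) H C‖ ≤ K * ε * Real.exp (-κ' * ((sInf {n : ℕ | ∃ S : Finset V₀, X ⊆ S ∧ Literature.Probability.LatticeModels.IsRConnected R S ∧ S.card = n + 1} : ℕ) : ℝ)) := by
  intro V₀ _ _ R _ nbr Δ hR hΔ hnbr hconn b hb κ κ' hκ' hκ
  exact geometric_resummation hR hΔ hnbr hconn hb hκ' hκ

end ItemShape

end Summit.QuantumFields.YangMills.Theorems.SteinerResummationDraft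

end
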